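/-
b2b-lace packet, ANALYTIC ORACLE seat gen 8 (unit `b2b-lace-oracle-g8`).  Leaf L1 of the (S2b)-IMPR interface
(HOME/GAPS.md "(S2b) SPLIT", item (I3)): the Fourier representation of the weighted diagram `ℋ^{n,l}_p(x)` on the
subcritical window, in DERIVATIVE-FREE form (the paper's `−ΔĜ_z(k)` is the cosine transform of `‖x‖₂² G_z(x)`).
d-generic; kernel proof over tree theorems; no numeral; no dimension sentence.
-/
import Literature.Probability.FitznerVanDerHofstad2017.SimpleDiagramFourierBound
import Literature.Probability.Percolation.TwoPointMoments
import HarnessLib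

/-!
# `ℋ^{n,l}_p(x) = ∫ D̂^{(x)}(k) · [Σ_y ‖y‖₂² τ_p(y) cos(k·y)] · τ̂_p(k)ⁿ D̂(k)^l dk/(2π)^d` for `p < p_c`

CITATION HEADER (PLACEMENT v2). Part of a certified REPRODUCTION of R. Fitzner, R. van der Hofstad,
*Generalized approach to the non-backtracking lace expansion*, Probab. Theory Related Fields 169 (2017)
1041–1119 [NoBLE17] (arXiv:1506.07969), §3.3.1 "Rewrite of `f₃`", as consumed by *Mean-field behavior for
nearest-neighbor percolation in `d > 10`*, Electron. J. Probab. 22 (2017) no. 43 [FvdH17], §2.3 (2.21)–(2.23):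

> [NoBLE17] §3.3.1 (PTRF pp. 1066–1067, (3.9)–(3.10) and the displays following them): "We analyze the function
> `ℋ^{n,l}_z(x) = Σ_y ‖y‖₂² G_z(y)(G_z^{⋆n} ⋆ D^{⋆l})(x−y)` … `Δ Ĝ_z(k) = −Σ_{x∈ℤ^d} ‖x‖₂² G_z(x) e^{ik·x}`.
> Thus, we can bound `ℋ^{n,l}_z(x)` using the Fourier representation
> `ℋ^{n,l}_z(x) = ∫_{(−π,π)^d} (−ΔĜ_z(k)) D̂^l(k) Ĝ_zⁿ(k) e^{−ik·x} d^dk/(2π)^d`."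
> [NoBLE17] §3.3.4 (PTRF p. 1071, after (3.38)): "For any function `f` such that `f(x) = f(p(x;ν,δ))` for all
> `ν, δ` …, we see that `∫ f̂(k) e^{−ik·x} d^dk/(2π)^d = ∫ f̂(k) D̂^{(x)}(k) d^dk/(2π)^d`. The functions `G_z`
> and `D` have these symmetries, so that we can replace `e^{ik·x}` in (the representation) by `D̂^{(x)}(k)`."

## What is proved (namespace `Literature.Probability.FitznerVanDerHofstad2017`)

For the percolation two-point function `G_z = τ_p` (the tree's `tau d p 0`), every `d ≥ 2`, every
`p < p_c(ℤ^d)` and all `n, l`, `x`: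

* `tauW d p = (y ↦ ‖y‖₂² τ_p(y))` and its cosine transform `tauWHat d p k = Σ_y ‖y‖₂² τ_p(y) cos(k·y)` — the
  paper's `−Δτ̂_p(k)` (the display for `ΔĜ_z` following (3.10)), typed WITHOUT derivatives (the weighted family is summable below `p_c`:
  `summable_normSq_mul_tau_of_lt_criticalProb`, from the tree's sharpness fact; `summable_tauW`);
  `isZdSymmetric_tauW` (total rotational symmetry, from `isZdSymmetric_tau` and `euclidNorm_signedPerm`).
* `nobleH_eq_latticeConv` — `ℋ^{n,l}_p = (‖·‖²τ_p) ⋆ (τ_p^{⋆n} ⋆ D^{⋆l})` (definitional).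
* `cosFT_convPowTau_conv_convPowStep` — `(τ_p^{⋆n} ⋆ D^{⋆l})^ = τ̂_pⁿ D̂^l`; `summable_nobleH`,
  `isZdSymmetric_nobleH`, `cosFT_nobleH` — `ℋ̂^{n,l}_p(k) = tauWHat(k) τ̂_p(k)ⁿ D̂(k)^l`.
* **`nobleH_eq_integral`** — the Fourier representation through the symmetrised exponential:
  `ℋ^{n,l}_p(x) = (2π)^{−d} ∫_{[−π,π]^d} D̂^{(x)}(k) · tauWHat d p k · τ̂_p(k)ⁿ · D̂(k)^l dk`
  (symmetrised Fourier inversion `eq_integral_DhatSym_mul_cosFT` + the convolution theorem).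

This is the entrance of [NoBLE17] §3.3.4–3.3.5 (the decomposition `−ΔĜ = Σ_{i=1}^5 Ĥ_i` of App. C and the
bounds (3.61)–(3.87) act on THIS integrand); those steps (leaves L2–L8 of HOME/GAPS.md) are not here.
-/

noncomputable section

namespace Literature.Probability.FitznerVanDerHofstad2017

open MeasureTheory Real Finset Filter
open scoped BigOperators
open Literature.Probability.LatticeModels
open Literature.Probability.Percolation
open Literature.Barriers.CriticalPhenomena
open Literature.Barriers.CriticalPhenomena.SpreadOutIsing (delta0 latticeConv convPow latticeConv_comm
  isZdSymmetric_latticeConv isZdSymmetric_convPow isZdSymmetric_delta0 isZdSymmetric_srwStep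
  euclidNorm_signedPerm)
open Literature.Barriers.CriticalPhenomena.Slade2006Prop53 (P)

variable {d : ℕ}

/-! ### The weight `‖y‖₂² τ_p(y)` and its cosine transform (the paper's `−Δτ̂_p`) -/

/-- The weighted two-point function `y ↦ ‖y‖₂² τ_p(y)` (the summand of `ℋ` and of `−Δτ̂_p`).
[cite: FitznerVanDerHofstad2016NoBLE, §3.3.1 (3.9)–(3.10) and the display for ΔĜ_z following them, PTRF pp. 1066–1067] -/
def tauW (d : ℕ) (p : unitInterval) : Site d → ℝ := fun y => euclidNorm y ^ 2 * tau d p 0 y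

/-- `tauWHat d p k = Σ_y ‖y‖₂² τ_p(y) cos(k·y)` — the paper's `−Δτ̂_p(k)` (the display
`ΔĜ_z(k) = −Σ_x ‖x‖₂² G_z(x) e^{ik·x}` following (3.10)), typed derivative-free as a cosine transform.
[cite: FitznerVanDerHofstad2016NoBLE, §3.3.1, the display for ΔĜ_z(k) following (3.10), PTRF p. 1067] -/
def tauWHat (d : ℕ) (p : unitInterval) (k : Fin d → ℝ) : ℝ := cosFT (tauW d p) k

/-- `tauWHat = cosFT tauW`. [folklore] -/
theorem tauWHat_eq_cosFT (p : unitInterval) : tauWHat d p = cosFT (tauW d p) := rfl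

/-- `‖y‖₂² τ_p(y) ≥ 0`. [folklore] -/
theorem tauW_nonneg (p : unitInterval) (y : Site d) : 0 ≤ tauW d p y :=
  mul_nonneg (sq_nonneg _) (tau_nonneg p 0 y)

/-- Total rotational symmetry of `‖·‖₂² τ_p`. [cite: FitznerVanDerHofstad2016NoBLE, Def. 2.5 p. 1058] -/
theorem isZdSymmetric_tauW (p : unitInterval) : IsZdSymmetric (tauW d p) := by
  intro σ ε x
  simp only [tauW, euclidNorm_signedPerm, isZdSymmetric_tau p σ ε x]

/-- Below `p_c` the weighted two-point function is summable (`Σ_x ‖x‖₂² τ_p(x) < ∞`, from the exponential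
decay of `τ_p`). [cite: DuminilCopinTassionCMP2016, Thm. 1.1 (1)] -/
theorem summable_tauW (hd : 2 ≤ d) (p : unitInterval) (hp : (p : ℝ) < criticalProb (zdGraph d) (0 : Site d)) :
    Summable (tauW d p) := by
  refine (summable_normSq_mul_tau_of_lt_criticalProb hd p hp).congr fun x => ?_
  simp only [tauW, euclidNorm, Real.sq_sqrt (Finset.sum_nonneg fun i _ => sq_nonneg _)]

/-! ### `ℋ` as a lattice convolution and its cosine transform -/

/-- `ℋ^{n,l}_p(x) = ((‖·‖₂² τ_p) ⋆ (τ_p^{⋆n} ⋆ D^{⋆l}))(x)` (the definition, read as a convolution).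
[cite: FitznerVanDerHofstad2016NoBLE, §3.3.1 (3.9)–(3.10), PTRF pp. 1066–1067] -/
theorem nobleH_eq_latticeConv (n l : ℕ) (p : unitInterval) (x : Site d) :
    nobleH d n l p x =
      latticeConv (tauW d p) (latticeConv (convPow (tau d p 0) n) (convPow (srwStep d) l)) x := rfl

/-- `τ_p^{⋆n} ⋆ D^{⋆l}` is summable when `τ_p(0,·)` is. [folklore] -/
theorem summable_convPowTau_conv_convPowStep {p : unitInterval} (hs : Summable fun x => tau d p 0 x)
    (n l : ℕ) : Summable (latticeConv (convPow (tau d p 0) n) (convPow (srwStep d) l)) :=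
  summable_latticeConv_of_summable (summable_convPow_tau hs n) (summable_convPow_srwStep l)

/-- `τ_p^{⋆n} ⋆ D^{⋆l}` is `W_d`-invariant. [cite: FitznerVanDerHofstad2016NoBLE, Def. 2.5 p. 1058] -/
theorem isZdSymmetric_convPowTau_conv_convPowStep (p : unitInterval) (n l : ℕ) :
    IsZdSymmetric (latticeConv (convPow (tau d p 0) n) (convPow (srwStep d) l)) :=
  isZdSymmetric_latticeConv (isZdSymmetric_convPow_tau p n) (isZdSymmetric_convPow isZdSymmetric_srwStep l)

/-- `(τ_p^{⋆n} ⋆ D^{⋆l})^(k) = τ̂_p(k)ⁿ D̂(k)^l`. [cite: HeydenreichVanDerHofstad2017, (1.2.16)–(1.2.17)] -/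
theorem cosFT_convPowTau_conv_convPowStep (hd : 1 ≤ d) {p : unitInterval}
    (hs : Summable fun x => tau d p 0 x) (n l : ℕ) (k : Fin d → ℝ) :
    cosFT (latticeConv (convPow (tau d p 0) n) (convPow (srwStep d) l)) k =
      tauHat d p k ^ n * Dhat d k ^ l := by
  rw [cosFT_latticeConv (summable_convPow_tau hs n) (summable_convPow_srwStep l) (convPow_srwStep_neg l),
    cosFT_convPow_tau hs n k, cosFT_convPow_srwStep hd l k]

/-- `ℋ^{n,l}_p` is summable for `p < p_c`. [folklore] -/
theorem summable_nobleH (hd : 2 ≤ d) (n l : ℕ) (p : unitInterval)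
    (hp : (p : ℝ) < criticalProb (zdGraph d) (0 : Site d)) : Summable (nobleH d n l p) := by
  have h := summable_latticeConv_of_summable (summable_tauW hd p hp)
    (summable_convPowTau_conv_convPowStep (summable_tau_of_lt_criticalProb hd p hp) n l)
  exact h.congr fun x => (nobleH_eq_latticeConv n l p x).symm

/-- `ℋ^{n,l}_p` is `W_d`-invariant. [cite: FitznerVanDerHofstad2016NoBLE, Def. 2.5 p. 1058] -/
theorem isZdSymmetric_nobleH (n l : ℕ) (p : unitInterval) : IsZdSymmetric (nobleH d n l p) := by
  intro σ ε x
  rw [nobleH_eq_latticeConv, nobleH_eq_latticeConv]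
  exact isZdSymmetric_latticeConv (isZdSymmetric_tauW p) (isZdSymmetric_convPowTau_conv_convPowStep p n l)
    σ ε x

/-- **`ℋ̂^{n,l}_p(k) = [Σ_y ‖y‖₂² τ_p(y) cos(k·y)] · τ̂_p(k)ⁿ · D̂(k)^l`** for `p < p_c` (convolution theorem).
[cite: FitznerVanDerHofstad2016NoBLE, §3.3.1, the Fourier representation of ℋ following (3.10), PTRF p. 1067]
[cite: HeydenreichVanDerHofstad2017, (1.2.16)–(1.2.17)] -/
theorem cosFT_nobleH (hd : 2 ≤ d) (n l : ℕ) (p : unitInterval)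
    (hp : (p : ℝ) < criticalProb (zdGraph d) (0 : Site d)) (k : Fin d → ℝ) :
    cosFT (nobleH d n l p) k = tauWHat d p k * (tauHat d p k ^ n * Dhat d k ^ l) := by
  have hs := summable_tau_of_lt_criticalProb hd p hp
  have hA := summable_convPowTau_conv_convPowStep hs n l
  have hAneg : ∀ y, latticeConv (convPow (tau d p 0) n) (convPow (srwStep d) l) (-y) =
      latticeConv (convPow (tau d p 0) n) (convPow (srwStep d) l) y :=
    fun y => (isZdSymmetric_convPowTau_conv_convPowStep p n l).neg y
  have e : nobleH d n l p = latticeConv (tauW d p)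
      (latticeConv (convPow (tau d p 0) n) (convPow (srwStep d) l)) :=
    funext fun x => nobleH_eq_latticeConv n l p x
  rw [e, cosFT_latticeConv (summable_tauW hd p hp) hA hAneg, cosFT_convPowTau_conv_convPowStep (by omega) hs,
    tauWHat]

/-! ### The Fourier representation of `ℋ` through `D̂^{(x)}` -/

/-- **Fourier representation of the weighted diagram** ([NoBLE17] §3.3.1 with the symmetrisation of §3.3.4):
for `d ≥ 2`, `p < p_c(ℤ^d)` and all `n, l, x`,
`ℋ^{n,l}_p(x) = ∫_{[−π,π]^d} D̂^{(x)}(k) · [Σ_y ‖y‖₂² τ_p(y) cos(k·y)] · τ̂_p(k)ⁿ · D̂(k)^l dk/(2π)^d`.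
[cite: FitznerVanDerHofstad2016NoBLE, §3.3.1 (the Fourier representation of ℋ following (3.10)), PTRF p. 1067; §3.3.4 (3.34) and the symmetrisation remark, p. 1071] -/
theorem nobleH_eq_integral (hd : 2 ≤ d) (n l : ℕ) (p : unitInterval)
    (hp : (p : ℝ) < criticalProb (zdGraph d) (0 : Site d)) (x : Site d) :
    nobleH d n l p x =
      (∫ k, DhatSym d x k * (tauWHat d p k * (tauHat d p k ^ n * Dhat d k ^ l)) ∂P d) / (2 * π) ^ d := by
  have h := eq_integral_DhatSym_mul_cosFT (summable_nobleH hd n l p hp) (isZdSymmetric_nobleH n l p) x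
  rw [h]
  congr 1
  refine integral_congr_ae (Eventually.of_forall fun k => ?_)
  simp only [cosFT_nobleH hd n l p hp k]

/-- The transform at `k = 0` is the second moment: `tauWHat d p 0 = Σ_y ‖y‖₂² τ_p(y)`. [folklore] -/
theorem tauWHat_zero (p : unitInterval) : tauWHat d p 0 = ∑' y, tauW d p y := by
  simp [tauWHat, cosFT, kdot]

/-- `|tauWHat d p k| ≤ Σ_y ‖y‖₂² τ_p(y)` for `p < p_c`. [folklore] -/
theorem abs_tauWHat_le (hd : 2 ≤ d) (p : unitInterval) (hp : (p : ℝ) < criticalProb (zdGraph d) (0 : Site d))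
    (k : Fin d → ℝ) : |tauWHat d p k| ≤ ∑' y, tauW d p y := by
  have h := abs_cosFT_le (summable_tauW hd p hp) k
  rw [tauWHat]
  refine h.trans_eq (tsum_congr fun y => abs_of_nonneg (tauW_nonneg p y))

end Literature.Probability.FitznerVanDerHofstad2017
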